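import Summits.BirchSwinnertonDyer.BirchSwinnertonDyer.Theorems.ManinLocalTwoThreeThreeBlindInvariance
import Summits.BirchSwinnertonDyer.BirchSwinnertonDyer.Theorems.ManinLocalTwoThreeManinPrimeToThreeAtNineOfNamedCubeLaws
import HarnessLib

/-!
# C3 stub 4 SPLIT: LAW₃ = NB₃ ∧ LAW₃♮ — skeleton v9 of `kato_shift_three` composed BY NAME

Summit `BirchSwinnertonDyer`, route `ManinLocalTwoThree` (cell bsd-f2-manin), crux C3 `ManinPrimeToThreeAtNine`
(stmt-BirchSwinnertonDyer-22968), line `kato_shift_three`.  With the cube criterion (`…CubeLawCubeCriterion`) and the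
`3`-blindness invariance (`…ThreeBlindInvariance`) the lead (p1 g5) RESHAPES stub 4 `stub_cubeExponentLaw` (LAW₃
`CuspidalKummerCubeExponentLaw`) into two `c`-free statements, both stated INLINE in tree vocabulary (typing ask T-p1-g5-1):

* **LAW₃♮** — LAW₃ with the extra hypothesis «`T♮ = (X₀/c², Y₀/c³)` is NOT `3`-blind»
  (`¬ IsThreeAdicFracCube (kummerCubeSeries W 1 (X₀/c²) (Y₀/c³) X)`), the exact twin of E-an-53's `¬ KummerBlindAtTwo`:
  C3-EQUIVALENT on its locus (`nonBlindLaw_of_locus` ⟸; `not_three_dvd_maninConstant_of_nonBlindLaw_of_representative` ⟹,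
  given K_geo₃), `c`-free, per-curve decidable;
* **NB₃** — no `X₀(N)`-optimal `W` with `9 ∣ N` carries a `3`-blind rational point of order `3` (Stevens-type optimality
  law; 0 exceptions `N < 5·10⁵`, lead's memo NB3-memo.md on the item).

Edges: `LAW₃ ⟸ NB₃ ∧ LAW₃♮` (`cuspidalKummerCubeExponentLaw_of_noBlind_of_nonBlindLaw`), `LAW₃ ⟹ LAW₃♮`, and the v9
COMPOSITION `ManinPrimeToThreeAtNine ⟸ F-es-18 ∧ E-an-57 ∧ LAW₃♮ ∧ NB₃ ∧ RES₃′`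
(`maninPrimeToThreeAtNine_of_katoFact_of_cuspidalKummerCube_of_nonBlindLaw_of_noBlind_of_orbitMinimal`).
CONDITIONAL edges only; nothing about BSD or Manin's conjecture is proved. [folklore]
-/

set_option autoImplicit false
set_option linter.dupNamespace false

noncomputable section

open scoped Classical
open PowerSeries WeierstrassCurve Literature.NumberTheory.EllipticCurves Literature.NumberTheory.EllipticCurves.ModularForms
  Literature.RingTheory.FormalGroups
open Summit.BirchSwinnertonDyer.Rank1Residual.ManinAdditive.CuspidalKummer
  Summit.BirchSwinnertonDyer.Rank1Residual.ManinAdditive.CuspidalKummerThree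

namespace Summit.BirchSwinnertonDyer.BirchSwinnertonDyer.Theorems.ManinLocalTwoThree

/-- **LAW₃ ⟸ NB₃ ∧ LAW₃♮** (the v9 split of stub 4): on an optimal `W` the point `T♮` is not `3`-blind by NB₃
(`isShortThreeTorsion_iff_intrinsic`), so LAW₃♮ applies.  CONDITIONAL edge. [folklore] -/
theorem cuspidalKummerCubeExponentLaw_of_noBlind_of_nonBlindLaw
    (hNB : ∀ (W : WeierstrassCurve ℚ) [W.IsElliptic] [W.IsGloballyMinimal] {N : ℕ} [NeZero N]
      (D : ModularParametrizationData W N),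
      (∀ z ∈ D.L.lattice, ∃ w ∈ periodLattice D.f, z = D.c * w) → 9 ∣ N →
      ∀ X₁ Y₁ : ℚ, IsShortThreeTorsion W 1 X₁ Y₁ → ¬ IsThreeAdicFracCube (kummerCubeSeries W 1 X₁ Y₁ X))
    (hLaw' : ∀ (W : WeierstrassCurve ℚ) [W.IsElliptic] [W.IsGloballyMinimal] {N : ℕ} [NeZero N]
      (D : ModularParametrizationData W N) (a : ℕ → ℤ), (∀ n, (a n : ℂ) = cuspCoeff D.f n) →
      9 ∣ N → (∀ z ∈ D.L.lattice, ∃ w ∈ periodLattice D.f, z = D.c * w) →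
      ∀ X₀ Y₀ : ℚ, IsShortThreeTorsion W D.c X₀ Y₀ →
      ¬ IsThreeAdicFracCube (kummerCubeSeries W 1 (X₀ / (D.c : ℚ) ^ 2) (Y₀ / (D.c : ℚ) ^ 3) X) →
      ∀ z : ℚ⟦X⟧, IsParamGerm W D.c a z →
      ∀ (r : ℕ → ℤ) (g A B : ℤ⟦X⟧), IsCuspidalKummerCubeRep N (kummerCubeSeries W D.c X₀ Y₀ z) r g A B →
      ∃ δ ∈ N.divisors, ¬ (3 : ℤ) ∣ r δ) :
    CuspidalKummerCubeExponentLaw := by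
  intro W _ _ N _ D a ha h9 hL X₀ Y₀ hT z hz r g A B hrep
  have hc0 : D.c ≠ 0 := D.maninConstant_ne_zero_holds
  have hT1 : IsShortThreeTorsion W 1 (X₀ / (D.c : ℚ) ^ 2) (Y₀ / (D.c : ℚ) ^ 3) :=
    (isShortThreeTorsion_iff_intrinsic W hc0 X₀ Y₀).mp hT
  exact hLaw' W D a ha h9 hL X₀ Y₀ hT (hNB W D hL h9 _ _ hT1) z hz r g A B hrep

/-- LAW₃ ⟹ LAW₃♮ (drop the non-blindness hypothesis). [folklore] -/
theorem nonBlindLaw_of_cuspidalKummerCubeExponentLaw (hLaw : CuspidalKummerCubeExponentLaw) :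
    ∀ (W : WeierstrassCurve ℚ) [W.IsElliptic] [W.IsGloballyMinimal] {N : ℕ} [NeZero N]
      (D : ModularParametrizationData W N) (a : ℕ → ℤ), (∀ n, (a n : ℂ) = cuspCoeff D.f n) →
      9 ∣ N → (∀ z ∈ D.L.lattice, ∃ w ∈ periodLattice D.f, z = D.c * w) →
      ∀ X₀ Y₀ : ℚ, IsShortThreeTorsion W D.c X₀ Y₀ →
      ¬ IsThreeAdicFracCube (kummerCubeSeries W 1 (X₀ / (D.c : ℚ) ^ 2) (Y₀ / (D.c : ℚ) ^ 3) X) →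
      ∀ z : ℚ⟦X⟧, IsParamGerm W D.c a z →
      ∀ (r : ℕ → ℤ) (g A B : ℤ⟦X⟧), IsCuspidalKummerCubeRep N (kummerCubeSeries W D.c X₀ Y₀ z) r g A B →
      ∃ δ ∈ N.divisors, ¬ (3 : ℤ) ∣ r δ :=
  fun W _ _ _N _ D a ha h9 hL X₀ Y₀ hT _ z hz r g A B hrep => hLaw W D a ha h9 hL X₀ Y₀ hT z hz r g A B hrep

/-- **LAW₃♮ ⟸ C3 on the rational-`3`-torsion locus** (HONESTY: LAW₃♮ asks no more than the crux does on its locus): at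
`3 ∤ c` a non-blind `T` has a non-cube `Θ_T`, so every representative has an exponent `≢ 0 (mod 3)`. [folklore] -/
theorem nonBlindLaw_of_locus
    (hC3 : ∀ (W : WeierstrassCurve ℚ) [W.IsElliptic] [W.IsGloballyMinimal] {N : ℕ} [NeZero N]
      (D : ModularParametrizationData W N),
      (∀ z ∈ D.L.lattice, ∃ w ∈ periodLattice D.f, z = D.c * w) → 9 ∣ N →
      ∀ X₀ Y₀ : ℚ, IsShortThreeTorsion W D.c X₀ Y₀ → ¬ (3 : ℤ) ∣ D.c) :
    ∀ (W : WeierstrassCurve ℚ) [W.IsElliptic] [W.IsGloballyMinimal] {N : ℕ} [NeZero N]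
      (D : ModularParametrizationData W N) (a : ℕ → ℤ), (∀ n, (a n : ℂ) = cuspCoeff D.f n) →
      9 ∣ N → (∀ z ∈ D.L.lattice, ∃ w ∈ periodLattice D.f, z = D.c * w) →
      ∀ X₀ Y₀ : ℚ, IsShortThreeTorsion W D.c X₀ Y₀ →
      ¬ IsThreeAdicFracCube (kummerCubeSeries W 1 (X₀ / (D.c : ℚ) ^ 2) (Y₀ / (D.c : ℚ) ^ 3) X) →
      ∀ z : ℚ⟦X⟧, IsParamGerm W D.c a z →
      ∀ (r : ℕ → ℤ) (g A B : ℤ⟦X⟧), IsCuspidalKummerCubeRep N (kummerCubeSeries W D.c X₀ Y₀ z) r g A B →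
      ∃ δ ∈ N.divisors, ¬ (3 : ℤ) ∣ r δ :=
  fun W _ _ _N _ D a ha h9 hL X₀ Y₀ hT hnb _z hz _r _g _A _B hrep =>
    exists_not_three_dvd_of_not_threeBlind W D a ha h9 X₀ Y₀ hz (hC3 W D hL h9 X₀ Y₀ hT) hnb hrep

/-- **LAW₃♮ ∧ K_geo₃ ⟹ C3 on the NON-BLIND rational-`3`-torsion locus**: for optimal `W`, `9 ∣ N`, and a rational
point of order `3` of `E_{W,c}` whose `T♮` is not `3`-blind, `3 ∤ c` (representative from E-an-57, an exponent `≢ 0` from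
LAW₃♮, non-cube by the cube criterion, then E-an-55).  CONDITIONAL edge. [folklore] -/
theorem not_three_dvd_maninConstant_of_nonBlindLaw_of_representative
    (hLaw' : ∀ (W : WeierstrassCurve ℚ) [W.IsElliptic] [W.IsGloballyMinimal] {N : ℕ} [NeZero N]
      (D : ModularParametrizationData W N) (a : ℕ → ℤ), (∀ n, (a n : ℂ) = cuspCoeff D.f n) →
      9 ∣ N → (∀ z ∈ D.L.lattice, ∃ w ∈ periodLattice D.f, z = D.c * w) →
      ∀ X₀ Y₀ : ℚ, IsShortThreeTorsion W D.c X₀ Y₀ →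
      ¬ IsThreeAdicFracCube (kummerCubeSeries W 1 (X₀ / (D.c : ℚ) ^ 2) (Y₀ / (D.c : ℚ) ^ 3) X) →
      ∀ z : ℚ⟦X⟧, IsParamGerm W D.c a z →
      ∀ (r : ℕ → ℤ) (g A B : ℤ⟦X⟧), IsCuspidalKummerCubeRep N (kummerCubeSeries W D.c X₀ Y₀ z) r g A B →
      ∃ δ ∈ N.divisors, ¬ (3 : ℤ) ∣ r δ)
    (h57 : CuspidalKummerCubeRepresentativeAtNine)
    (W : WeierstrassCurve ℚ) [W.IsElliptic] [W.IsGloballyMinimal] {N : ℕ} [NeZero N]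
    (D : ModularParametrizationData W N) (h9 : 9 ∣ N)
    (hL : ∀ z ∈ D.L.lattice, ∃ w ∈ periodLattice D.f, z = D.c * w)
    {X₀ Y₀ : ℚ} (hT : IsShortThreeTorsion W D.c X₀ Y₀)
    (hnb : ¬ IsThreeAdicFracCube (kummerCubeSeries W 1 (X₀ / (D.c : ℚ) ^ 2) (Y₀ / (D.c : ℚ) ^ 3) X)) :
    ¬ (3 : ℤ) ∣ D.c := by
  intro h3
  set a : ℕ → ℤ := fun n => W.LFunction n with ha_def
  have ha : ∀ n, (a n : ℂ) = cuspCoeff D.f n := fun n => (D.isNewformOf.2 n).symm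
  obtain ⟨z, hz⟩ := exists_isParamGerm W D.c a
  obtain ⟨r, g, A, B, hrep⟩ := h57 W D a ha h9 hL X₀ Y₀ hT z hz
  obtain ⟨δ, hδ, hnd⟩ := hLaw' W D a ha h9 hL X₀ Y₀ hT hnb z hz r g A B hrep
  have hΘ0 : constantCoeff (kummerCubeSeries W D.c X₀ Y₀ z) ≠ 0 := by
    rw [constantCoeff_kummerCubeSeries W D.c X₀ Y₀ hz.1]; norm_num
  exact hnd (forall_three_dvd_of_isThreeAdicFracCube hΘ0 (ManinThreeKummerCube_holds W D a ha h9 X₀ Y₀ hT z hz h3) hrep δ hδ)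

/-- **C3 `ManinPrimeToThreeAtNine` BY NAME from F-es-18, E-an-57, LAW₃♮, NB₃ and RES₃′** — the composition of skeleton v9 of
line `kato_shift_three` (stub 4 split).  CONDITIONAL. [cite: Kato2004Asterisque, Thm. 9.7 (p. 189)] -/
theorem maninPrimeToThreeAtNine_of_katoFact_of_cuspidalKummerCube_of_nonBlindLaw_of_noBlind_of_orbitMinimal
    (hK : kato_neron_isIntegral_twistedSymbolSum_of_additive_three_polar)
    (h57 : CuspidalKummerCubeRepresentativeAtNine)
    (hLaw' : ∀ (W : WeierstrassCurve ℚ) [W.IsElliptic] [W.IsGloballyMinimal] {N : ℕ} [NeZero N]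
      (D : ModularParametrizationData W N) (a : ℕ → ℤ), (∀ n, (a n : ℂ) = cuspCoeff D.f n) →
      9 ∣ N → (∀ z ∈ D.L.lattice, ∃ w ∈ periodLattice D.f, z = D.c * w) →
      ∀ X₀ Y₀ : ℚ, IsShortThreeTorsion W D.c X₀ Y₀ →
      ¬ IsThreeAdicFracCube (kummerCubeSeries W 1 (X₀ / (D.c : ℚ) ^ 2) (Y₀ / (D.c : ℚ) ^ 3) X) →
      ∀ z : ℚ⟦X⟧, IsParamGerm W D.c a z →
      ∀ (r : ℕ → ℤ) (g A B : ℤ⟦X⟧), IsCuspidalKummerCubeRep N (kummerCubeSeries W D.c X₀ Y₀ z) r g A B →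
      ∃ δ ∈ N.divisors, ¬ (3 : ℤ) ∣ r δ)
    (hNB : ∀ (W : WeierstrassCurve ℚ) [W.IsElliptic] [W.IsGloballyMinimal] {N : ℕ} [NeZero N]
      (D : ModularParametrizationData W N),
      (∀ z ∈ D.L.lattice, ∃ w ∈ periodLattice D.f, z = D.c * w) → 9 ∣ N →
      ∀ X₁ Y₁ : ℚ, IsShortThreeTorsion W 1 X₁ Y₁ → ¬ IsThreeAdicFracCube (kummerCubeSeries W 1 X₁ Y₁ X))
    (hRes : NoRationalThreeTorsionOrbitMinimalResidual) :
    Summit.BirchSwinnertonDyer.BirchSwinnertonDyer.Theses.ManinLocalTwoThree.ManinPrimeToThreeAtNine :=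
  maninPrimeToThreeAtNine_of_katoFact_of_namedCubeLaws hK h57
    (cuspidalKummerCubeExponentLaw_of_noBlind_of_nonBlindLaw hNB hLaw') hRes

end Summit.BirchSwinnertonDyer.BirchSwinnertonDyer.Theorems.ManinLocalTwoThree

end
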